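import Literature.Barriers.NavierStokesRegularity.InstantaneousTypeIBlowup
import Literature.Analysis.FluidPDE.NavierStokesConcentrationCorrectorProofs
import Literature.Analysis.FluidPDE.NavierStokesReynoldsProofs
import Literature.Analysis.FluidPDE.NavierStokesConcentrationTools
import Literature.Analysis.FluidPDE.TorusWeakNSGluing
import Literature.Analysis.FluidPDE.WeakSolutionSingularTime
import Literature.Analysis.FluidPDE.TorusHeatForcedIcc
import Literature.Analysis.FunctionSpaces.TorusClassicalNSGluing
import HarnessLib

/-!
# Cheskidov–Dai–Palasek 2025, Thm. 1.1: proof architecture one level down — §6 of the paper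
# (the background, Lemma 6.1 at the singular time, and the assembly) proved

Sibling proof file (all results proved; no definitions, no named facts) of the barrier entry
`Literature/Barriers/NavierStokesRegularity/InstantaneousTypeIBlowup` (D-0021), whose named
fact `InstantaneousTypeIBlowup` renders Thm. 1.1 (with Rmks. 1.2–1.3) of A. Cheskidov, M. Dai,
S. Palasek, *Instantaneous Type I blow-up and non-uniqueness of smooth solutions of the
Navier–Stokes equations*, arXiv:2511.09556 (2025). Triage of the discharge: SIZE XL — the
printed proof is a theory (§3: a multi-scale principal part realising a complete inverse
energy cascade; §4: its residual estimates, over Littlewood–Paley / heat-semigroup /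
Hölder–Zygmund calculus on `𝕋^d` with the commutator, stationary-phase and oscillation lemmas of
the appendix; §5: the semigroup of the linearisation with a fractional Grönwall inequality and a
fixed point in a slightly subcritical Koch–Tataru-type space; Prop. 6.2: the borderline
classes). This file formalises the LAST level of the printed proof — §6 ("Proof of main
results") together with the first line of the construction (the classical background) — and
isolates everything else as ONE explicit hypothesis, stated over the accepted torus vocabulary,
of the assembly theorem `InstantaneousTypeIBlowup_of_construction` (D-0026: the hypothesis is a
slice of the proof of Thm. 1.1, not a distinct published result, so it is NOT vendored as a
named fact; it is the remaining proof obligation of the barrier fact).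

Proved here:

* `exists_isClassicalNSSolutionOn_of_isSmooth` — **the background `U`** (§1 / Rmk. 1.4: Leray's
  local-in-time classical solution from smooth data, here on `𝕋^d`, `d ≥ 2`): for smooth
  divergence-free `u₀` there are `T > 0` and a classical solution `(u, p)` of the unforced
  Navier–Stokes equations on `[0, T] × 𝕋^d` with `u(0) = u₀`. Proof: `u = u₀ + v`, where `v`
  solves the linearised stress-forced system (3.2) of Cheskidov–Luo 2022 around the frozen
  Navier–Stokes–Reynolds triple `(u₀, 0, ℛ((u₀·∇)u₀ - Δu₀))` (`exists_isNSReynoldsOn_const`, by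
  the tree's antidivergence `Torus.exists_smooth_antidivergence_holds`), solved on a short
  interval by the tree's Fourier–Picard theorem `Torus.CheskidovLuo2022LocalExistence_holds`.
* `isWeakNSSolutionWithDataOn_of_classical_Ioc` — **Lemma 6.1 at the singular time**: a
  classical solution on `(0, T] × 𝕋^d` which is `L²_{t,x}`, Type-I bounded
  (`‖u(t,x)‖ ≤ C/√t`) and converges in `𝒟'` to `a` as `t → 0⁺` is a weak solution on `[0, T)`
  with datum `a` (accepted `Torus.IsWeakNSSolutionWithDataOn`). Printed proof: the classical
  identity on `[t₀, T]` has boundary term `∫ u(t₀)·φ(t₀)` (tree: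
  `Torus.setIntegral_weakIntegrand_eq_sub`); let `t₀ → 0⁺`, the cross term
  `∫ u(t₀)·(φ(t₀) - φ(0))` being `O(√t₀)` by the Type-I bound and the time-Lipschitz bound of
  test fields (`exists_norm_sub_zero_le_mul_of_isSpaceTimeTest`); the other piece of Lemma 6.1
  (classical up to the singular time) is the tree's gluing theorem
  `Torus.IsWeakNSSolutionWithDataOn.glue`.
* `InstantaneousTypeIBlowup_of_construction` — **the assembly (§6, proof of Thm. 1.1)**: IF for
  every classical background `(U, P)` on `[0, T] × 𝕋ⁿ` (`n ≥ 2`, `0 < T ≤ T₁(n)`) and every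
  `T_* ∈ [0, T)` the construction of §§3–5 delivers a classical solution on `(0, T - T_*]`
  continuous in `𝒟'` at `0⁺` with value `U(T_*)`, in `L²_{t,x} ∩ L²_t L^p_x`, with the lower
  bound (2), the Type-I bounds (4) and the Orlicz bounds (5) (hypothesis `hH`, see its
  docstring for the clause-by-clause account), THEN `InstantaneousTypeIBlowup`. The Lean content:
  `T := min (T_{Leray}(u₀)) T₁`; the solution is `U` on `[0, T_*]` followed by `u(· - T_*)`;
  weak solution by Lemma 6.1 (both pieces) — for `T_* = 0` the construction alone
  (`isWeakNSSolutionWithDataOn_congr_Ioo`); (1) by restriction of `U`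
  (`Torus.IsClassicalNSSolutionOn.mono`); (2), (4) and classicality on `(T_*, T]` by time
  translation (`isClassicalNSSolutionOn_Ioc_translate`); Rmk. 1.2 slice-wise; (5) on `(0, T)`
  from continuity in time of `t ↦ ‖U(t)‖_∞`, `t ↦ ‖∇U(t)‖_∞` on `[0, T]`
  (`continuousOn_iSup_norm`, `continuousOn_iSup_norm_fderiv`, `continuousOn_orliczWeight`) and
  translation invariance of integrability (`integrableOn_Ioo_comp_sub`); (6) by
  `Torus.memLqLp_glue` with `U ∈ L²_t L^p_x` (`memLqLp_of_norm_le`).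

Remaining obligation (hypothesis `hH`; SIZE XL, see the barrier file's `because:` block):
§3 (Lemmas 3.1–3.2, the potentials `ψ_{j,k}`, `v`, `R_k`), §4 (Props. 4.1–4.3), §5
(Lemma 5.1, Props. 5.2–5.3 with `N₀ = 1`, `T̄ = T - T_*`), Prop. 6.2 (`L²_t L^p_x`, and the
`𝒟'`-continuity at the blow-up time, which print takes from the Koch–Tataru path-space
membership and [Hou 2024]), the lower bound "`v(tₙ) ∼ tₙ^{-1/2} e^{-1}`" of the proof of
Thm. 1.1, and the Orlicz bounds (5), which print states in Thm. 1.1 and explains in Rmk. 1.3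
("`f` is allowed to grow roughly as the inverse function of `k ↦ N_k`") without a displayed proof.

## References

* A. Cheskidov, M. Dai, S. Palasek, arXiv:2511.09556 (2025): §1 (Leray's local theory),
  Rmk. 1.4, §1.7 (time translation), Lemma 6.1, Prop. 6.2, proof of Thm. 1.1 (§6).
  [`CheskidovDaiPalasek2025`]
* A. Cheskidov, X. Luo, Invent. Math. 229 (2022) = arXiv:2009.06596, §2.6 (the frozen
  Navier–Stokes–Reynolds triple), §3.1 (3.2) (local solvability of the linearised system).
  [`CheskidovLuo2022`]
* J. Leray, Acta Math. 63 (1934) (local classical solutions). [`Leray1934`]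
-/

noncomputable section

open MeasureTheory Set Filter Topology
open scoped ENNReal InnerProductSpace ContDiff

namespace Literature.Barriers.NavierStokesRegularity

open Literature.Analysis
open Literature.Analysis.FunctionSpaces.Torus (IsSmooth IsDivFree IsContDiff IsSmoothSpaceTimeOn
  HasZeroMean isSmoothSpaceTimeOn_const)

/-! ## Step 0 of the printed proof: the classical background `U` from the smooth datum
(Leray's local existence of classical solutions on the torus) -/

section LocalExistence

variable {d : Type*} [Fintype d] [DecidableEq d]

omit [Fintype d] [DecidableEq d] in
/-- The one-sided time derivative of a time-independent field on the torus vanishes. [folklore] -/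
theorem timeDerivWithin_const_field {F : Type*} [NormedAddCommGroup F] [NormedSpace ℝ F]
    (S : Set ℝ) (w : UnitAddTorus d → F) (t : ℝ) (x : UnitAddTorus d) :
    FunctionSpaces.Torus.timeDerivWithin S (fun _ : ℝ => w) t x = 0 := by
  simp [FunctionSpaces.Torus.timeDerivWithin]

/-- **A smooth divergence-free field, frozen in time, solves the Navier–Stokes–Reynolds system**
with zero pressure and the stress `R = ℛ((u₀·∇)u₀ - Δu₀)` (the source has zero mean:
`∫ (u₀·∇)u₀ = 0` for divergence-free `u₀`, `∫ Δu₀ = 0`; Cheskidov–Luo 2022, §2.6, first line of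
the proof of Thm. 1.7, here without the zero-mean hypothesis on the velocity).
[cite: CheskidovLuo2022, §2.6 (proof of Thm. 1.7)] -/
theorem exists_isNSReynoldsOn_const (hd : 2 ≤ Fintype.card d) (T : ℝ)
    {u₀ : UnitAddTorus d → EuclideanSpace ℝ d} (hs : IsSmooth u₀) (hdiv : IsDivFree u₀) :
    ∃ R : ℝ → UnitAddTorus d → d → EuclideanSpace ℝ d,
      FluidPDE.Torus.IsNSReynoldsOn (Icc 0 T) 1 (fun _ => u₀) (fun _ _ => 0) R := by
  -- the source `f = (u₀·∇)u₀ - Δu₀`, constant in time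
  set f : ℝ → UnitAddTorus d → EuclideanSpace ℝ d := fun _ x =>
    FunctionSpaces.Torus.convect u₀ u₀ x - FunctionSpaces.Torus.laplacian u₀ x with hf_def
  have hf : IsSmoothSpaceTimeOn (Icc 0 T) f :=
    isSmoothSpaceTimeOn_const ((hs.convect hs).sub hs.laplacian) _
  have hfmean : ∀ t ∈ Icc 0 T, HasZeroMean (f t) := by
    intro t _
    have h2 : ∫ x, FunctionSpaces.Torus.convect u₀ u₀ x = 0 :=
      FunctionSpaces.Torus.integral_fderiv_apply_eq_zero_of_isDivFree hs hs hdiv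
    have h3 : ∫ x, FunctionSpaces.Torus.laplacian u₀ x = 0 := by
      rw [integral_congr_ae (ae_of_all _ fun x =>
        FunctionSpaces.Torus.laplacian_eq_sum_partialDeriv_partialDeriv hs x),
        integral_finsetSum _ fun i _ => ((hs.partialDeriv i).partialDeriv i).integrable]
      exact Finset.sum_eq_zero fun i _ => FunctionSpaces.Torus.integral_partialDeriv_eq_zero_holds (hs.partialDeriv i) i
    have i2 : Integrable (FunctionSpaces.Torus.convect u₀ u₀) volume := (hs.convect hs).integrable
    have i3 : Integrable (FunctionSpaces.Torus.laplacian u₀) volume := hs.laplacian.integrable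
    change ∫ x, f t x = 0
    simp only [hf_def]
    rw [integral_sub i2 i3, h2, h3, sub_zero]
  obtain ⟨R, hR, hsymm, htr, hdivR⟩ := FluidPDE.Torus.exists_smooth_antidivergence_holds (d := d) hd T f hf hfmean
  refine ⟨R, ?_⟩
  exact
    { smooth_velocity := isSmoothSpaceTimeOn_const hs _
      smooth_pressure := contDiffOn_const
      smooth_stress := hR
      momentum := fun t ht x => by
        rw [hdivR t ht x, FluidPDE.Torus.gradient_zero, one_smul, add_zero, timeDerivWithin_const_field,
          zero_add]
        simp only [hf_def]
        abel
      divFree := fun _ _ => hdiv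
      symm := hsymm
      traceFree := htr
      hasZeroMean_pressure := fun t _ => by simp [FunctionSpaces.Torus.HasZeroMean] }

/-- **Local existence of classical solutions on the torus from smooth data (Leray).** For
`d ≥ 2` and a smooth divergence-free `u₀` on `𝕋^d` there are `T > 0` and a classical solution
`(u, p)` of the unforced Navier–Stokes equations (viscosity `1`) on `[0, T] × 𝕋^d` with
`u(0) = u₀` (Cheskidov–Dai–Palasek 2025, §1: "local-in-time existence of classical solutions from
any smooth initial data" [Leray 1934]; this is the background `U` of the construction, Rmk. 1.4).
Proof: write `u = u₀ + v`; then `v` solves the linearised stress-forced system (3.2) of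
Cheskidov–Luo 2022 around the frozen Navier–Stokes–Reynolds triple of
`exists_isNSReynoldsOn_const`, which the tree solves on short intervals
(`Torus.CheskidovLuo2022LocalExistence_holds`, Fourier–Picard).
[cite: CheskidovDaiPalasek2025, §1 and Rmk. 1.4] [cite: CheskidovLuo2022, §3.1 (3.2)] -/
theorem exists_isClassicalNSSolutionOn_of_isSmooth (hd : 2 ≤ Fintype.card d)
    {u₀ : UnitAddTorus d → EuclideanSpace ℝ d} (hs : IsSmooth u₀) (hdiv : IsDivFree u₀) :
    ∃ T : ℝ, 0 < T ∧ ∃ (u : ℝ → UnitAddTorus d → EuclideanSpace ℝ d) (p : ℝ → UnitAddTorus d → ℝ),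
      FunctionSpaces.Torus.IsClassicalNSSolutionOn (Icc 0 T) 1 0 u p ∧ u 0 = u₀ := by
  obtain ⟨R, hNSR⟩ := exists_isNSReynoldsOn_const hd 1 hs hdiv
  obtain ⟨n₀, hn₀, H⟩ := FluidPDE.Torus.CheskidovLuo2022LocalExistence_holds hd 1 one_pos (fun _ => u₀)
    (fun _ _ => 0) R hNSR 1 one_pos
  obtain ⟨v, q, hsol, -⟩ := H n₀ le_rfl 0 hn₀
  simp only [Nat.cast_zero, zero_mul, zero_add, one_mul] at hsol
  set θ : ℝ := 1 / (n₀ : ℝ) with hθ_def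
  have hn₀' : (0 : ℝ) < n₀ := by exact_mod_cast hn₀
  have hθ : 0 < θ := by positivity
  have hθ1 : θ ≤ 1 := by
    rw [hθ_def, div_le_one hn₀']
    exact_mod_cast hn₀
  have hU : UniqueDiffOn ℝ (Icc 0 θ) := uniqueDiffOn_Icc hθ
  have hsub : Icc 0 θ ⊆ Icc 0 1 := Icc_subset_Icc le_rfl hθ1
  have hu₀S : IsSmoothSpaceTimeOn (Icc 0 θ) (fun _ : ℝ => u₀) := isSmoothSpaceTimeOn_const hs _
  refine ⟨θ, hθ, fun t x => u₀ x + v t x, q, ?_, ?_⟩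
  · exact
      { smooth_velocity := hu₀S.add hsol.smooth_v
        smooth_pressure := hsol.smooth_q
        momentum := fun t ht x => by
          have hvt : IsSmooth (v t) := hsol.smooth_v.isSmooth_slice ht
          have hv1 : IsContDiff 1 (v t) := hvt.isContDiff (by simp)
          have hu1 : IsContDiff 1 u₀ := hs.isContDiff (by simp)
          -- the two equations
          have hN := hNSR.momentum t (hsub ht) x
          rw [timeDerivWithin_const_field, zero_add, FluidPDE.Torus.gradient_zero, add_zero, one_smul] at hN
          have hL := hsol.momentum t ht x
          -- expand the sum field
          rw [FunctionSpaces.Torus.timeDerivWithin_add hu₀S hsol.smooth_v hU ht x, timeDerivWithin_const_field,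
            zero_add, FluidPDE.Torus.convect_add_left, FluidPDE.Torus.convect_add_right _ hu1 hv1,
            FluidPDE.Torus.convect_add_right _ hu1 hv1, FluidPDE.Torus.laplacian_add_apply hs hvt, one_smul,
            Pi.zero_apply, Pi.zero_apply, add_zero]
          have e1 := sub_eq_zero.2 hL
          have e2 := sub_eq_zero.2 hN
          refine sub_eq_zero.1 ?_
          calc FunctionSpaces.Torus.timeDerivWithin (Icc 0 θ) v t x +
                (FunctionSpaces.Torus.convect u₀ u₀ x + FunctionSpaces.Torus.convect u₀ (v t) x +
                  (FunctionSpaces.Torus.convect (v t) u₀ x +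
                    FunctionSpaces.Torus.convect (v t) (v t) x)) -
                (FunctionSpaces.Torus.laplacian u₀ x + FunctionSpaces.Torus.laplacian (v t) x -
                  FunctionSpaces.Torus.gradient (q t) x)
              = (FunctionSpaces.Torus.timeDerivWithin (Icc 0 θ) v t x +
                    FunctionSpaces.Torus.convect (v t) (v t) x +
                    FunctionSpaces.Torus.convect u₀ (v t) x +
                    FunctionSpaces.Torus.convect (v t) u₀ x +
                    FunctionSpaces.Torus.gradient (q t) x -
                  (FunctionSpaces.Torus.laplacian (v t) x - FluidPDE.Torus.tensorDivergence (R t) x)) +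
                (FunctionSpaces.Torus.convect u₀ u₀ x -
                  (FunctionSpaces.Torus.laplacian u₀ x + FluidPDE.Torus.tensorDivergence (R t) x)) := by abel
            _ = 0 := by rw [e1, e2, add_zero]
        divFree := fun t ht =>
          FunctionSpaces.Torus.IsDivFree.add (hs.isContDiff (by simp))
            ((hsol.smooth_v.isSmooth_slice ht).isContDiff (by simp)) hdiv (hsol.divFree t ht) }
  · funext x
    simp [hsol.initial x]

end LocalExistence

/-! ## Lemma 6.1 of the paper (the half at the singular time): a classical solution on
`(0, T]`, square integrable, Type-I bounded and continuous in `𝒟'` at `t = 0`, is a weak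
solution with the limiting datum -/

section SingularStart

variable {d : Type*} [Fintype d] [DecidableEq d]

omit [DecidableEq d] in
/-- For a space–time test field, `τ ↦ ψ(τ, x)` has derivative `∂ₜψ(t, x)` at every `t`
(vector-valued twin of `IsSpaceTimeTest.hasDerivAt_apply`). [folklore] -/
theorem hasDerivAt_slice_of_isSpaceTimeTest {F : Type*} [NormedAddCommGroup F] [NormedSpace ℝ F]
    {T : ℝ} {ψ : ℝ → UnitAddTorus d → F} (hψ : FunctionSpaces.Torus.IsSpaceTimeTest T ψ) (t : ℝ)
    (x : UnitAddTorus d) :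
    HasDerivAt (fun τ => ψ τ x) (FunctionSpaces.Torus.timeDeriv ψ t x) t := by
  have hd : Differentiable ℝ (FunctionSpaces.Torus.stLift ψ) := hψ.1.differentiable (by simp)
  have h1 : Differentiable ℝ fun τ : ℝ =>
      FunctionSpaces.Torus.stLift ψ (τ, FunctionSpaces.Torus.repr x) :=
    hd.comp (differentiable_id.prodMk (differentiable_const _))
  have heq : (fun τ : ℝ => FunctionSpaces.Torus.stLift ψ (τ, FunctionSpaces.Torus.repr x)) =
      fun τ => ψ τ x := by
    funext τ
    simp [FunctionSpaces.Torus.stLift, FunctionSpaces.Torus.proj_repr]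
  rw [heq] at h1
  exact (h1 t).hasDerivAt

omit [DecidableEq d] in
/-- **Test fields are Lipschitz in time, uniformly in space, on `[0, T]`**: there is `L ≥ 0` with
`‖ψ(s, x) - ψ(0, x)‖ ≤ L s` for `s ∈ [0, T]` (mean value inequality with a uniform bound of
`∂ₜψ` on the compact `[0, T] × 𝕋^d`). [folklore] -/
theorem exists_norm_sub_zero_le_mul_of_isSpaceTimeTest {F : Type*} [NormedAddCommGroup F]
    [NormedSpace ℝ F] {T : ℝ} {ψ : ℝ → UnitAddTorus d → F}
    (hψ : FunctionSpaces.Torus.IsSpaceTimeTest T ψ) :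
    ∃ L : ℝ, 0 ≤ L ∧ ∀ s ∈ Icc 0 T, ∀ x, ‖ψ s x - ψ 0 x‖ ≤ L * s := by
  obtain ⟨L, hL⟩ := hψ.exists_bound_timeDeriv isCompact_Icc (K := Icc 0 T)
  by_cases hT : 0 ≤ T
  · have hL0 : 0 ≤ L := (norm_nonneg _).trans (hL 0 ⟨le_rfl, hT⟩ 0)
    refine ⟨L, hL0, fun s hs x => ?_⟩
    have h := norm_image_sub_le_of_norm_deriv_le_segment' (f := fun τ => ψ τ x)
      (f' := fun τ => FunctionSpaces.Torus.timeDeriv ψ τ x) (a := 0) (b := T)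
      (fun τ _ => (hasDerivAt_slice_of_isSpaceTimeTest hψ τ x).hasDerivWithinAt)
      (fun τ hτ => hL τ (Ico_subset_Icc_self hτ) x) s hs
    simpa using h
  · exact ⟨0, le_rfl, fun s hs => absurd (hs.1.trans hs.2) hT⟩

/-- **Cheskidov–Dai–Palasek 2025, Lemma 6.1 (at the singular time).** Let `(u, q)` be a
classical solution of the unforced Navier–Stokes equations (viscosity `ν`) on `(0, T] × 𝕋^d`,
`T > 0`, with `u ∈ L²((0,T) × 𝕋^d)`, obeying the Type-I bound `‖u(t, x)‖ ≤ C/√t`, and such that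
`u(t) → a` in `𝒟'(𝕋^d)` as `t → 0⁺` (`∫⟪u(t), φ⟫ → ∫⟪a, φ⟫` for every smooth `φ`). Then `u` is a
weak solution on `𝕋^d × [0, T)` with datum `a` (accepted `Torus.IsWeakNSSolutionWithDataOn`).
Printed: "`u ∈ L²(𝕋^d × [0,T]) ∩ L^∞([0,T]; H^s)` … classical on `[0,T_*)` and `(T_*,T]` … If
`lim_{t→T_*⁻} u(t) = lim_{t→T_*⁺} u(t)` in `𝒟'`, then `u` is a weak solution on `[0,T]`"; proof:
test on `[t₀, T]`, where the classical computation gives the boundary term `∫ u(t₀)·φ(t₀)`, and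
let `t₀ → T_*⁺`, using `∫ u(t₀)·(φ(t₀) - φ(T_*)) → 0`. Here the blow-up time is `0`, the
left piece is absent (it is supplied by the tree's gluing theorem
`Torus.IsWeakNSSolutionWithDataOn.glue`), and the printed `L^∞_t H^s_x` control of the
cross term is replaced by the Type-I bound of Thm. 1.1 (4): `|∫ u(t₀)·(φ(t₀) - φ(0))| ≤
(C/√t₀) · L t₀ → 0`. [cite: CheskidovDaiPalasek2025, Lemma 6.1] -/
theorem isWeakNSSolutionWithDataOn_of_classical_Ioc {T ν C : ℝ} (hT : 0 < T)
    {u : ℝ → UnitAddTorus d → EuclideanSpace ℝ d} {q : ℝ → UnitAddTorus d → ℝ}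
    {a : UnitAddTorus d → EuclideanSpace ℝ d}
    (hcl : FunctionSpaces.Torus.IsClassicalNSSolutionOn (Ioc 0 T) ν 0 u q)
    (hL2 : ∫⁻ t in Ioo 0 T, ∫⁻ x, ‖u t x‖ₑ ^ 2 < ⊤)
    (hC : ∀ t ∈ Ioc 0 T, ∀ x, ‖u t x‖ ≤ C / Real.sqrt t)
    (hlim : ∀ φ : UnitAddTorus d → EuclideanSpace ℝ d, IsSmooth φ →
      Tendsto (fun t => ∫ x, ⟪u t x, φ x⟫_ℝ) (𝓝[>] 0) (𝓝 (∫ x, ⟪a x, φ x⟫_ℝ))) :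
    FunctionSpaces.Torus.IsWeakNSSolutionWithDataOn T ν a u := by
  have hS : Convex ℝ (Ioc 0 T) := convex_Ioc 0 T
  have hU : UniqueDiffOn ℝ (Ioc 0 T) := uniqueDiffOn_Ioc 0 T
  have hu : IsSmoothSpaceTimeOn (Ioc 0 T) u := hcl.smooth_velocity
  have hm : AEStronglyMeasurable (FunctionSpaces.Torus.stLift u)
      (volume.restrict (Ioo 0 T ×ˢ univ)) :=
    hu.aestronglyMeasurable_stLift measurableSet_Ioo Ioo_subset_Ioc_self
  refine ⟨hm, hL2, ?_, fun ψ hψ hdiv => ?_⟩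
  · filter_upwards [ae_restrict_mem measurableSet_Ioo] with t ht
    exact (hcl.divFree t (Ioo_subset_Ioc_self ht)).isWeaklyDivFree_holds
      (hu.isSmooth_slice (Ioo_subset_Ioc_self ht))
  · -- the weak-form functional and the pairing
    set Φ : ℝ → ℝ := fun t => ∫ x, (⟪u t x, FunctionSpaces.Torus.timeDeriv ψ t x⟫_ℝ +
      ⟪u t x, FunctionSpaces.Torus.convect (u t) (ψ t) x⟫_ℝ +
      ν * ⟪u t x, FunctionSpaces.Torus.laplacian (ψ t) x⟫_ℝ) with hΦ_def
    set E : ℝ → ℝ := fun t => ∫ x, ⟪u t x, ψ t x⟫_ℝ with hE_def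
    have hΦi : IntegrableOn Φ (Ioo 0 T) := FluidPDE.Torus.integrableOn_nsWeakFunctional hm hL2 hψ
    obtain ⟨-, T', hT'T, hψ0⟩ := id hψ
    have hψT : ψ T = 0 := hψ0 T hT'T.le
    have hET : E T = 0 := by simp [hE_def, hψT]
    -- Step 1: the classical identity on `[ε, T]`, `0 < ε < T`
    have hid : ∀ ε ∈ Ioo 0 T, ∫ t in Ioo ε T, Φ t = -E ε := by
      intro ε hε
      have h := FluidPDE.Torus.setIntegral_weakIntegrand_eq_sub hcl hS hU hψ hdiv hε.2
        (fun t ht => ⟨hε.1.trans_le ht.1, ht.2⟩)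
      simp only [Pi.zero_apply, inner_zero_left, add_zero] at h
      rw [h]
      change E T - E ε = -E ε
      rw [hET, zero_sub]
    -- Step 2: a sequence `εₖ ↓ 0` in `(0, T)`
    set ε : ℕ → ℝ := fun k => T / ((k : ℝ) + 2) with hε_def
    have hεmem : ∀ k, ε k ∈ Ioo 0 T := fun k => by
      have hk : (0 : ℝ) ≤ k := Nat.cast_nonneg k
      refine ⟨by positivity, ?_⟩
      rw [hε_def, div_lt_iff₀ (by positivity)]
      nlinarith
    have hε0 : Tendsto ε atTop (𝓝 0) :=
      tendsto_const_nhds.div_atTop (tendsto_natCast_atTop_atTop.atTop_add tendsto_const_nhds)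
    have hεw : Tendsto ε atTop (𝓝[>] 0) :=
      tendsto_nhdsWithin_iff.2 ⟨hε0, Eventually.of_forall fun k => (hεmem k).1⟩
    -- Step 3: `∫_{(εₖ, T)} Φ → ∫_{(0, T)} Φ`
    have hmono : Monotone fun k => Ioo (ε k) T := by
      intro k l hkl
      refine Ioo_subset_Ioo ?_ le_rfl
      rw [hε_def]
      have hk : (0 : ℝ) ≤ k := Nat.cast_nonneg k
      have hkl' : (k : ℝ) ≤ l := by exact_mod_cast hkl
      exact div_le_div_of_nonneg_left hT.le (by positivity) (by linarith)
    have hUnion : (⋃ k, Ioo (ε k) T) = Ioo 0 T := by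
      refine Subset.antisymm (iUnion_subset fun k => Ioo_subset_Ioo (hεmem k).1.le le_rfl) ?_
      intro t ht
      obtain ⟨k, hk⟩ := (hε0.eventually (gt_mem_nhds ht.1)).exists
      exact mem_iUnion.2 ⟨k, hk, ht.2⟩
    have hlim1 : Tendsto (fun k => ∫ t in Ioo (ε k) T, Φ t) atTop (𝓝 (∫ t in Ioo 0 T, Φ t)) := by
      have h := tendsto_setIntegral_of_monotone (μ := volume) (f := Φ)
        (fun k => measurableSet_Ioo) hmono (by rwa [hUnion])
      rwa [hUnion] at h
    -- Step 4: `E(εₖ) → ∫⟪a, ψ(0)⟫`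
    have hlim2 : Tendsto (fun k => E (ε k)) atTop (𝓝 (∫ x, ⟪a x, ψ 0 x⟫_ℝ)) := by
      obtain ⟨L, hL0, hL⟩ := exists_norm_sub_zero_le_mul_of_isSpaceTimeTest hψ
      have hψ0s : IsSmooth (ψ 0) := hψ.isSmooth_slice 0
      have hC0 : 0 ≤ C := by
        have h := hC T ⟨hT, le_rfl⟩ 0
        have : 0 ≤ C / Real.sqrt T := (norm_nonneg _).trans h
        exact (div_nonneg_iff.1 this).elim (fun h => h.1)
          (fun h => absurd h.2 (not_le.2 (Real.sqrt_pos.2 hT)))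
      -- split `E(ε) = ∫⟪u(ε), ψ(0)⟫ + ∫⟪u(ε), ψ(ε) - ψ(0)⟫`
      have hsplit : ∀ k, E (ε k) = (∫ x, ⟪u (ε k) x, ψ 0 x⟫_ℝ) +
          ∫ x, ⟪u (ε k) x, ψ (ε k) x - ψ 0 x⟫_ℝ := by
        intro k
        have hus : IsSmooth (u (ε k)) := hu.isSmooth_slice (Ioo_subset_Ioc_self (hεmem k))
        have hψs : IsSmooth (ψ (ε k)) := hψ.isSmooth_slice _
        have i1 : Integrable (fun x => ⟪u (ε k) x, ψ 0 x⟫_ℝ) volume :=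
          (hus.continuous.inner hψ0s.continuous).integrable_unitAddTorus
        have i2 : Integrable (fun x => ⟪u (ε k) x, ψ (ε k) x - ψ 0 x⟫_ℝ) volume :=
          (hus.continuous.inner (hψs.continuous.sub hψ0s.continuous)).integrable_unitAddTorus
        rw [← integral_add i1 i2]
        refine integral_congr_ae (ae_of_all _ fun x => ?_)
        simp only [inner_sub_right]
        ring
      have hmain : Tendsto (fun k => ∫ x, ⟪u (ε k) x, ψ 0 x⟫_ℝ) atTop (𝓝 (∫ x, ⟪a x, ψ 0 x⟫_ℝ)) :=
        (hlim (ψ 0) hψ0s).comp hεw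
      have herr : Tendsto (fun k => ∫ x, ⟪u (ε k) x, ψ (ε k) x - ψ 0 x⟫_ℝ) atTop (𝓝 0) := by
        have hbound : ∀ k, ‖∫ x, ⟪u (ε k) x, ψ (ε k) x - ψ 0 x⟫_ℝ‖ ≤ C * L * Real.sqrt (ε k) := by
          intro k
          have hεk := hεmem k
          have hsq : 0 < Real.sqrt (ε k) := Real.sqrt_pos.2 hεk.1
          have h1 : ∀ x, ‖⟪u (ε k) x, ψ (ε k) x - ψ 0 x⟫_ℝ‖ ≤ C * L * Real.sqrt (ε k) := by
            intro x
            calc ‖⟪u (ε k) x, ψ (ε k) x - ψ 0 x⟫_ℝ‖ ≤ ‖u (ε k) x‖ * ‖ψ (ε k) x - ψ 0 x‖ :=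
                  norm_inner_le_norm _ _
              _ ≤ (C / Real.sqrt (ε k)) * (L * ε k) :=
                  mul_le_mul (hC _ (Ioo_subset_Ioc_self hεk) x)
                    (hL _ ⟨hεk.1.le, hεk.2.le⟩ x) (norm_nonneg _) (by positivity)
              _ = C * L * (ε k / Real.sqrt (ε k)) := by ring
              _ = C * L * Real.sqrt (ε k) := by rw [Real.div_sqrt]
          calc ‖∫ x, ⟪u (ε k) x, ψ (ε k) x - ψ 0 x⟫_ℝ‖
              ≤ (C * L * Real.sqrt (ε k)) * (volume (univ : Set (UnitAddTorus d))).toReal :=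
                norm_integral_le_of_norm_le_const (ae_of_all _ h1)
            _ = C * L * Real.sqrt (ε k) := by simp
        have hsqrt : Tendsto (fun k => C * L * Real.sqrt (ε k)) atTop (𝓝 0) := by
          have h := (hε0.sqrt).const_mul (C * L)
          simpa using h
        exact squeeze_zero_norm hbound hsqrt
      have h := hmain.add herr
      simp only [add_zero] at h
      refine h.congr' (Eventually.of_forall fun k => (hsplit k).symm)
    -- Step 5: conclude by uniqueness of limits
    have hlim3 : Tendsto (fun k => ∫ t in Ioo (ε k) T, Φ t) atTop (𝓝 (-(∫ x, ⟪a x, ψ 0 x⟫_ℝ))) :=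
      hlim2.neg.congr' (Eventually.of_forall fun k => (hid (ε k) (hεmem k)).symm)
    have heq := tendsto_nhds_unique hlim1 hlim3
    change (∫ t in Ioo 0 T, Φ t) + ∫ x, ⟪a x, ψ 0 x⟫_ℝ = 0
    rw [heq, neg_add_cancel]

end SingularStart

/-! ## Bookkeeping for the assembly: time translation, agreement on the open time interval,
mixed norms of bounded fields, and continuity of sup norms in time -/

section Bookkeeping

variable {d : Type*} [Fintype d] [DecidableEq d]

/-- **Time translation of classical solutions** from `(0, T']` to `(a, a + T']`
(the equations are autonomous; `Torus.IsSmoothSpaceTimeOn.comp_add_const`,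
`Torus.timeDerivWithin_comp_add_const`). [folklore] -/
theorem isClassicalNSSolutionOn_Ioc_translate {ν a T' : ℝ}
    {u : ℝ → UnitAddTorus d → EuclideanSpace ℝ d} {q : ℝ → UnitAddTorus d → ℝ}
    (h : FunctionSpaces.Torus.IsClassicalNSSolutionOn (Ioc 0 T') ν 0 u q) :
    FunctionSpaces.Torus.IsClassicalNSSolutionOn (Ioc a (a + T')) ν 0 (fun t => u (t - a))
      (fun t => q (t - a)) := by
  have hpre : (· + -a) ⁻¹' Ioc 0 T' = Ioc a (a + T') := by
    ext t
    simp only [mem_preimage, mem_Ioc]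
    constructor <;> rintro ⟨h1, h2⟩ <;> constructor <;> linarith
  have hsm := h.smooth_velocity.comp_add_const (-a)
  have hsq := h.smooth_pressure.comp_add_const (-a)
  rw [hpre] at hsm hsq
  simp only [← sub_eq_add_neg] at hsm hsq
  exact
    { smooth_velocity := hsm
      smooth_pressure := hsq
      momentum := fun t ht x => by
        have hta : t - a ∈ Ioc 0 T' := ⟨by linarith [ht.1], by linarith [ht.2]⟩
        have hder := FluidPDE.Torus.timeDerivWithin_comp_add_const (Ioc 0 T') u (-a) t x
        rw [hpre] at hder
        simp only [← sub_eq_add_neg] at hder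
        rw [hder]
        simpa using h.momentum (t - a) hta x
      divFree := fun t ht => h.divFree (t - a) ⟨by linarith [ht.1], by linarith [ht.2]⟩ }

/-- The accepted weak formulation with datum only sees the field at times `t ∈ (0, T)`. [folklore] -/
theorem isWeakNSSolutionWithDataOn_congr_Ioo {T ν : ℝ} {u₀ : UnitAddTorus d → EuclideanSpace ℝ d}
    {u w : ℝ → UnitAddTorus d → EuclideanSpace ℝ d}
    (h : FunctionSpaces.Torus.IsWeakNSSolutionWithDataOn T ν u₀ u) (hw : ∀ t ∈ Ioo 0 T, w t = u t) :
    FunctionSpaces.Torus.IsWeakNSSolutionWithDataOn T ν u₀ w := by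
  obtain ⟨hm, h2, hdiv, hweak⟩ := h
  have hst : ∀ p ∈ Ioo 0 T ×ˢ (univ : Set (EuclideanSpace ℝ d)),
      FunctionSpaces.Torus.stLift w p = FunctionSpaces.Torus.stLift u p := by
    rintro ⟨t, y⟩ hp
    simp [FunctionSpaces.Torus.stLift, hw t hp.1]
  refine ⟨?_, ?_, ?_, fun ψ hψ hψdiv => ?_⟩
  · exact hm.congr ((ae_restrict_mem (measurableSet_Ioo.prod MeasurableSet.univ)).mono
      fun p hp => (hst p hp).symm)
  · have e : (∫⁻ t in Ioo 0 T, ∫⁻ x, ‖w t x‖ₑ ^ 2) = ∫⁻ t in Ioo 0 T, ∫⁻ x, ‖u t x‖ₑ ^ 2 :=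
      setLIntegral_congr_fun measurableSet_Ioo fun t ht => by rw [hw t ht]
    rw [e]
    exact h2
  · filter_upwards [hdiv, ae_restrict_mem measurableSet_Ioo] with t ht ht'
    rwa [hw t ht']
  · have e : (∫ t in Ioo 0 T, ∫ x, (⟪w t x, FunctionSpaces.Torus.timeDeriv ψ t x⟫_ℝ +
        ⟪w t x, FunctionSpaces.Torus.convect (w t) (ψ t) x⟫_ℝ +
        ν * ⟪w t x, FunctionSpaces.Torus.laplacian (ψ t) x⟫_ℝ)) =
        ∫ t in Ioo 0 T, ∫ x, (⟪u t x, FunctionSpaces.Torus.timeDeriv ψ t x⟫_ℝ +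
        ⟪u t x, FunctionSpaces.Torus.convect (u t) (ψ t) x⟫_ℝ +
        ν * ⟪u t x, FunctionSpaces.Torus.laplacian (ψ t) x⟫_ℝ) :=
      setIntegral_congr_fun measurableSet_Ioo fun t ht => by rw [hw t ht]
    rw [e]
    exact hweak ψ hψ hψdiv

omit [DecidableEq d] in
/-- Mixed Lebesgue classes only see the field at times of the given set. [folklore] -/
theorem memLqLp_congr_set {F : Type*} [NormedAddCommGroup F] {q r : ℝ≥0∞} {S : Set ℝ}
    (hS : MeasurableSet S) {u w : ℝ → UnitAddTorus d → F} (h : FluidPDE.Torus.MemLqLp q r u S)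
    (hw : ∀ t ∈ S, w t = u t) : FluidPDE.Torus.MemLqLp q r w S := by
  refine ⟨?_, ?_⟩
  · filter_upwards [h.1, ae_restrict_mem hS] with t ht ht'
    rwa [hw t ht']
  · have h2 : eLpNorm (fun t => (eLpNorm (u t) r volume).toReal) q (volume.restrict S) < ⊤ := h.2
    change eLpNorm (fun t => (eLpNorm (w t) r volume).toReal) q (volume.restrict S) < ⊤
    have e : (fun t => (eLpNorm (w t) r volume).toReal) =ᵐ[volume.restrict S]
        fun t => (eLpNorm (u t) r volume).toReal :=
      (ae_restrict_mem hS).mono fun t ht => by simp only [hw t ht]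
    rwa [eLpNorm_congr_ae e]

omit [DecidableEq d] in
/-- A field continuous and uniformly bounded on the slices `t ∈ (0, T)` lies in every
`L^q(0,T; L^r(𝕋^d))`. [folklore] -/
theorem memLqLp_of_norm_le {q r : ℝ≥0∞} {T M : ℝ} {u : ℝ → UnitAddTorus d → EuclideanSpace ℝ d}
    (hc : ∀ t ∈ Ioo 0 T, Continuous (u t)) (hM : ∀ t ∈ Ioo 0 T, ∀ x, ‖u t x‖ ≤ M) :
    FluidPDE.Torus.MemLqLp q r u (Ioo 0 T) := by
  have hM' : ∀ t ∈ Ioo 0 T, ∀ x, ‖u t x‖ ≤ max M 0 := fun t ht x => (hM t ht x).trans (le_max_left _ _)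
  have hmem : ∀ᵐ t ∂(volume.restrict (Ioo 0 T)), MemLp (u t) r volume := by
    filter_upwards [ae_restrict_mem measurableSet_Ioo] with t ht
    exact (memLp_top_of_bound (hc t ht).aestronglyMeasurable M (ae_of_all _ (hM t ht))).mono_exponent
      le_top
  have hle : ∀ᵐ t ∂(volume.restrict (Ioo 0 T)),
      ‖(eLpNorm (u t) r volume).toReal‖ ≤ max M 0 := by
    filter_upwards [ae_restrict_mem measurableSet_Ioo] with t ht
    have h1 : eLpNorm (u t) r volume ≤ ENNReal.ofReal (max M 0) := by
      refine (eLpNorm_le_of_ae_bound (ae_of_all _ (hM' t ht))).trans ?_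
      simp
    rw [Real.norm_eq_abs, abs_of_nonneg ENNReal.toReal_nonneg]
    exact ENNReal.toReal_le_of_le_ofReal (le_max_right _ _) h1
  refine ⟨hmem, ?_⟩
  change eLpNorm (fun t => (eLpNorm (u t) r volume).toReal) q (volume.restrict (Ioo 0 T)) < ⊤
  refine lt_of_le_of_lt (eLpNorm_le_of_ae_bound hle) ?_
  refine ENNReal.mul_lt_top ?_ ENNReal.ofReal_lt_top
  rw [Measure.restrict_apply_univ, Real.volume_Ioo]
  exact ENNReal.rpow_lt_top_of_nonneg (by positivity) ENNReal.ofReal_ne_top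

omit [Fintype d] [DecidableEq d] in
/-- Integrability on `(a, a + T')` of `g(· - a)` from integrability of `g` on `(0, T')`. [folklore] -/
theorem integrableOn_Ioo_comp_sub {g : ℝ → ℝ} {a T' : ℝ} (hg : IntegrableOn g (Ioo 0 T')) :
    IntegrableOn (fun t => g (t - a)) (Ioo a (a + T')) := by
  have h := (FluidPDE.Torus.measurePreserving_sub_right_Ioo a (a + T')).integrable_comp_emb
    (MeasurableEquiv.subRight a).measurableEmbedding (g := g)
  rw [add_sub_cancel_left] at h
  exact h.2 hg

omit [Fintype d] [DecidableEq d] in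
/-- **Sup norms of slices depend continuously on time.** If `(t, y) ↦ h t (proj y)` is
continuous on `[a, b] × ℝ^d`, then `t ↦ sup_x h t x` is continuous on `[a, b]` (the torus is the
continuous image of the compact unit cube; Mathlib `IsCompact.continuous_sSup`). [folklore] -/
theorem continuousOn_iSup_of_continuousOn {a b : ℝ} {h : ℝ → UnitAddTorus d → ℝ}
    (hc : ContinuousOn (FunctionSpaces.Torus.stLift h) (Icc a b ×ˢ univ)) :
    ContinuousOn (fun t => ⨆ x, h t x) (Icc a b) := by
  set K : Set (EuclideanSpace ℝ d) :=
    ((WithLp.toLp 2) '' (Set.pi univ fun _ : d => Icc (0 : ℝ) 1)) with hK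
  have hKc : IsCompact K := FunctionSpaces.Torus.isCompact_toLp_image_pi_Icc
  have h1 : Continuous fun p : Icc a b × EuclideanSpace ℝ d =>
      FunctionSpaces.Torus.stLift h ((p.1 : ℝ), p.2) :=
    hc.comp_continuous ((continuous_subtype_val.comp continuous_fst).prodMk continuous_snd)
      fun p => ⟨p.1.2, mem_univ _⟩
  have h2 : Continuous fun s : Icc a b =>
      sSup ((fun y => FunctionSpaces.Torus.stLift h ((s : ℝ), y)) '' K) :=
    hKc.continuous_sSup (f := fun (s : Icc a b) (y : EuclideanSpace ℝ d) =>
      FunctionSpaces.Torus.stLift h ((s : ℝ), y)) h1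
  have hEq : ∀ t : ℝ, sSup ((fun y => FunctionSpaces.Torus.stLift h (t, y)) '' K) = ⨆ x, h t x := by
    intro t
    have hset : (fun y => FunctionSpaces.Torus.stLift h (t, y)) '' K = range fun x => h t x := by
      ext r
      constructor
      · rintro ⟨y, -, rfl⟩
        exact ⟨FunctionSpaces.Torus.proj y, rfl⟩
      · rintro ⟨x, rfl⟩
        exact ⟨FunctionSpaces.Torus.repr x, FunctionSpaces.Torus.repr_mem_toLp_image_pi_Icc x,
          by simp [FunctionSpaces.Torus.proj_repr]⟩
    rw [hset]
    rfl
  rw [continuousOn_iff_continuous_restrict]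
  refine h2.congr fun s => ?_
  exact hEq s

omit [DecidableEq d] in
/-- The sup norm `t ↦ sup_x ‖u(t, x)‖` of a jointly smooth field is continuous in time. [folklore] -/
theorem continuousOn_iSup_norm {a b : ℝ} {u : ℝ → UnitAddTorus d → EuclideanSpace ℝ d}
    (hu : IsSmoothSpaceTimeOn (Icc a b) u) :
    ContinuousOn (fun t => ⨆ x, ‖u t x‖) (Icc a b) :=
  continuousOn_iSup_of_continuousOn (h := fun t x => ‖u t x‖) hu.continuousOn_stLift.norm

omit [DecidableEq d] in
/-- The sup norm `t ↦ sup_x ‖∇u(t, x)‖` of the spatial derivative of a jointly smooth field is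
continuous in time (the slice derivatives are `D(stLift u)(t, y) ∘ inr`,
`Torus.IsSmoothSpaceTimeOn.fderiv_slice_apply`). [folklore] -/
theorem continuousOn_iSup_norm_fderiv {a b : ℝ} (hab : a < b)
    {u : ℝ → UnitAddTorus d → EuclideanSpace ℝ d} (hu : IsSmoothSpaceTimeOn (Icc a b) u) :
    ContinuousOn (fun t => ⨆ x, ‖FunctionSpaces.Torus.fderiv (u t) x‖) (Icc a b) := by
  have hU : UniqueDiffOn ℝ (Icc a b ×ˢ (univ : Set (EuclideanSpace ℝ d))) :=
    (uniqueDiffOn_Icc hab).prod uniqueDiffOn_univ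
  set G : ℝ × EuclideanSpace ℝ d → EuclideanSpace ℝ d →L[ℝ] EuclideanSpace ℝ d := fun p =>
    (fderivWithin ℝ (FunctionSpaces.Torus.stLift u) (Icc a b ×ˢ univ) p).comp
      (ContinuousLinearMap.inr ℝ ℝ (EuclideanSpace ℝ d)) with hG
  have hD : ContDiffOn ℝ (⊤ : ℕ∞)
      (fun p => fderivWithin ℝ (FunctionSpaces.Torus.stLift u) (Icc a b ×ˢ univ) p)
      (Icc a b ×ˢ univ) := hu.fderivWithin hU le_rfl
  have hGc : ContinuousOn G (Icc a b ×ˢ univ) :=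
    ((ContinuousLinearMap.compL ℝ (EuclideanSpace ℝ d) (ℝ × EuclideanSpace ℝ d)
      (EuclideanSpace ℝ d)).flip (ContinuousLinearMap.inr ℝ ℝ (EuclideanSpace ℝ d))).continuous
      |>.comp_continuousOn hD.continuousOn
  have hEq : ∀ p ∈ Icc a b ×ˢ (univ : Set (EuclideanSpace ℝ d)),
      FunctionSpaces.Torus.stLift (fun t x => ‖FunctionSpaces.Torus.fderiv (u t) x‖) p = ‖G p‖ := by
    rintro ⟨t, y⟩ hp
    rw [FunctionSpaces.Torus.stLift_apply]
    congr 1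
    ext w
    · rw [hu.fderiv_slice_apply (mem_prod.1 hp).1]
      rfl
  refine continuousOn_iSup_of_continuousOn (h := fun t x => ‖FunctionSpaces.Torus.fderiv (u t) x‖) ?_
  exact (hGc.norm).congr hEq

/-- The Orlicz weights of Thm. 1.1 (5) are continuous in the sup norm: for `g` continuous and
nonnegative on `[a, b]` and `c > 0`, `t ↦ g(t)^m / (1 + (log log(e + g t))^c)` is continuous on
`[a, b]`. [folklore] -/
theorem continuousOn_orliczWeight {a b c : ℝ} (hc : 0 < c) (m : ℕ) {g : ℝ → ℝ}
    (hg : ContinuousOn g (Icc a b)) (hg0 : ∀ t, 0 ≤ g t) :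
    ContinuousOn (fun t => g t ^ m /
      (1 + Real.log (Real.log (Real.exp 1 + g t)) ^ c)) (Icc a b) := by
  have he : ∀ t, 0 < Real.exp 1 + g t := fun t => add_pos_of_pos_of_nonneg (Real.exp_pos 1) (hg0 t)
  have hlog1 : ∀ t, 1 ≤ Real.log (Real.exp 1 + g t) := fun t => by
    rw [Real.le_log_iff_exp_le (he t)]
    linarith [hg0 t]
  have hlog2 : ∀ t, 0 ≤ Real.log (Real.log (Real.exp 1 + g t)) := fun t =>
    Real.log_nonneg (hlog1 t)
  have h1 : ContinuousOn (fun t => Real.log (Real.exp 1 + g t)) (Icc a b) :=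
    (continuousOn_const.add hg).log fun t _ => (he t).ne'
  have h2 : ContinuousOn (fun t => Real.log (Real.log (Real.exp 1 + g t))) (Icc a b) :=
    h1.log fun t _ => by linarith [hlog1 t]
  have h3 : ContinuousOn (fun t => Real.log (Real.log (Real.exp 1 + g t)) ^ c) (Icc a b) :=
    h2.rpow_const fun t _ => Or.inr hc.le
  refine (hg.pow m).div (continuousOn_const.add h3) fun t _ => ?_
  have : 0 ≤ Real.log (Real.log (Real.exp 1 + g t)) ^ c := Real.rpow_nonneg (hlog2 t) c
  linarith

end Bookkeeping

/-! ## The assembly: §6 of the paper (proof of Thm. 1.1 from the construction of §§3–5) -/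

section Assembly

/-- **Cheskidov–Dai–Palasek 2025, Thm. 1.1 from the construction of §§3–5 (the assembly of
§6, proved).** HYPOTHESIS `hH` — the remaining proof obligation of the barrier fact, NOT a
named fact (D-0026): it is what §§3–5 with Prop. 6.2 deliver for an ARBITRARY classical
background, read after the time translation `T_* ↦ 0` of §1.7 ("we may translate in time to
arrange that `U` is instead a solution on `[-T_*, T - T_*]`") and transported to the unit torus
(viscosity `1`; the paper's `T ∈ (0, 1]` on `(ℝ/2πℤ)^d` becomes `T ≤ T₁` for some `T₁ > 0`,
which only weakens `hH`). For `n ≥ 2` there is `T₁ > 0` such that for every classical solution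
`(U, P)` on `[0, T] × 𝕋ⁿ`, `0 < T ≤ T₁` (Thm. 1.6: "`U` any classical solution … `T ∈ (0,1]`"),
and every `T_* ∈ [0, T)`, there is a classical solution `(u, q)` on `(0, T - T_*] × 𝕋ⁿ` — the
paper's `U(· + T_*) + v + w`, `v` the principal part of §3 (Prop. 4.3), `w ∈ B_X(0, δ)` the
corrector of Prop. 5.3 with `N₀ = 1`, `T̄ = T - T_*` — such that: `u(t) → U(T_*)` in `𝒟'(𝕋ⁿ)` as
`t → 0⁺` (Thm. 1.1 (3): weak-* continuity into `BMO⁻¹`, with `u(T_*) = U(T_*)`);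
`u ∈ L²((0, T - T_*) × 𝕋ⁿ)` and `u ∈ L²(0, T - T_*; L^p)` for all `p < ∞` (Thm. 1.1 (6),
Prop. 6.2); the lower bound `‖u(tₖ)‖_∞ ≥ c/√tₖ` along `tₖ → 0⁺` (Thm. 1.1 (2)); the Type-I bounds
`‖u(t, x)‖ ≤ C/√t`, `‖∇u(t, x)‖ ≤ C/t` (Thm. 1.1 (4)); and the two Orlicz bounds of Thm. 1.1 (5)
on `(0, T - T_*)`. CONCLUSION: the barrier fact `InstantaneousTypeIBlowup`. This is the Lean
content of §6: the background `U` from `u₀` is Leray's local classical solution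
(`exists_isClassicalNSSolutionOn_of_isSmooth`, on `[0, T]` with `T ≤ T₁`); the solution of
Thm. 1.1 is `U` on `[0, T_*]` followed by `u(· - T_*)`; it is a weak solution on `[0, T)` with
datum `u₀` by Lemma 6.1 (`isWeakNSSolutionWithDataOn_of_classical_Ioc` at the singular time and
the tree's gluing theorem `Torus.IsWeakNSSolutionWithDataOn.glue`, the classical `U` being a
weak solution by `Torus.IsClassicalNSSolutionOn.isWeakNSSolutionForcedOn_holds`); properties
(1), (2), (4), Rmk. 1.2 are read off the two pieces; (5) and (6) on `(0, T)` combine the bounded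
smooth piece `U|[0,T_*]` (continuity of the sup norms in time) with the translated bounds of `u`.
[cite: CheskidovDaiPalasek2025, §6 (proof of Thm. 1.1), Lemma 6.1, Prop. 6.2] -/
theorem InstantaneousTypeIBlowup_of_construction
    (hH : ∀ (n : ℕ), 2 ≤ n → ∃ T₁ : ℝ, 0 < T₁ ∧ ∀ (T : ℝ), 0 < T → T ≤ T₁ →
      ∀ (U : ℝ → UnitAddTorus (Fin n) → EuclideanSpace ℝ (Fin n)) (P : ℝ → UnitAddTorus (Fin n) → ℝ),
        FunctionSpaces.Torus.IsClassicalNSSolutionOn (Icc 0 T) 1 0 U P →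
        ∀ Ts : ℝ, 0 ≤ Ts → Ts < T →
          ∃ (u : ℝ → UnitAddTorus (Fin n) → EuclideanSpace ℝ (Fin n)) (q : ℝ → UnitAddTorus (Fin n) → ℝ),
            FunctionSpaces.Torus.IsClassicalNSSolutionOn (Ioc 0 (T - Ts)) 1 0 u q ∧
            (∀ φ : UnitAddTorus (Fin n) → EuclideanSpace ℝ (Fin n), FunctionSpaces.Torus.IsSmooth φ →
              Tendsto (fun t => ∫ x, ⟪u t x, φ x⟫_ℝ) (𝓝[>] 0) (𝓝 (∫ x, ⟪U Ts x, φ x⟫_ℝ))) ∧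
            (∫⁻ t in Ioo 0 (T - Ts), ∫⁻ x, ‖u t x‖ₑ ^ 2 < ⊤) ∧
            (∀ p : ℝ, 1 ≤ p →
              FluidPDE.Torus.MemLqLp 2 (ENNReal.ofReal p) u (Ioo 0 (T - Ts))) ∧
            (∃ c : ℝ, 0 < c ∧ ∃ s : ℕ → ℝ, (∀ k, 0 < s k ∧ s k ≤ T - Ts) ∧
              Tendsto s atTop (𝓝 0) ∧ ∀ k, ∃ x, c / Real.sqrt (s k) ≤ ‖u (s k) x‖) ∧
            (∃ C : ℝ, ∀ t ∈ Ioc 0 (T - Ts), ∀ x, ‖u t x‖ ≤ C / Real.sqrt t ∧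
              ‖FunctionSpaces.Torus.fderiv (u t) x‖ ≤ C / t) ∧
            (∃ c : ℝ, 0 < c ∧ IntegrableOn (fun t : ℝ => (⨆ x, ‖u t x‖) ^ 2 /
              (1 + Real.log (Real.log (Real.exp 1 + ⨆ x, ‖u t x‖)) ^ c)) (Ioo 0 (T - Ts))) ∧
            (∃ c : ℝ, 0 < c ∧ IntegrableOn (fun t : ℝ =>
              (⨆ x, ‖FunctionSpaces.Torus.fderiv (u t) x‖) /
              (1 + Real.log (Real.log (Real.exp 1 +
                ⨆ x, ‖FunctionSpaces.Torus.fderiv (u t) x‖)) ^ c)) (Ioo 0 (T - Ts)))) :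
    InstantaneousTypeIBlowup := by
  intro n hn u₀ hs hd
  have hd' : 2 ≤ Fintype.card (Fin n) := by simpa using hn
  obtain ⟨T₁, hT₁, hH⟩ := hH n hn
  -- Step 0: the classical background `U` from `u₀`, on `[0, T]` with `T ≤ T₁`
  obtain ⟨T₀, hT₀, U, P, hUcl, hU0⟩ := exists_isClassicalNSSolutionOn_of_isSmooth hd' hs hd
  set T : ℝ := min T₀ T₁ with hT_def
  have hT : 0 < T := lt_min hT₀ hT₁
  have hTT₀ : T ≤ T₀ := min_le_left _ _
  have hTT₁ : T ≤ T₁ := min_le_right _ _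
  have hUT : FunctionSpaces.Torus.IsClassicalNSSolutionOn (Icc 0 T) 1 0 U P :=
    hUcl.mono (Icc_subset_Icc le_rfl hTT₀) (uniqueDiffOn_Icc hT)
  have hUsm : IsSmoothSpaceTimeOn (Icc 0 T) U := hUT.smooth_velocity
  obtain ⟨M, hM⟩ := hUsm.exists_norm_le_of_isCompact isCompact_Icc Subset.rfl
  -- `U` is a weak solution with datum `u₀` on `[0, T)`
  have hUw : FunctionSpaces.Torus.IsWeakNSSolutionWithDataOn T 1 u₀ U := by
    have h := FunctionSpaces.Torus.IsClassicalNSSolutionOn.isWeakNSSolutionForcedOn_holds hUT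
      Subset.rfl
    rw [FluidPDE.Torus.isWeakNSSolutionForcedOn_zero_iff, hU0] at h
    exact h
  refine ⟨T, hT, fun Ts hTs0 hTsT => ?_⟩
  -- the construction after the blow-up time
  obtain ⟨u, q, hucl, hulim, huL2, huLp, ⟨c, hc, s, hsI, hslim, hlow⟩, ⟨C, hCb⟩,
    ⟨c₁, hc₁, hI₁⟩, ⟨c₂, hc₂, hI₂⟩⟩ := hH T hT hTT₁ U P hUT Ts hTs0 hTsT
  have hTs' : 0 < T - Ts := sub_pos.2 hTsT
  have husm : IsSmoothSpaceTimeOn (Ioc 0 (T - Ts)) u := hucl.smooth_velocity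
  -- Lemma 6.1: the piece after the blow-up time is a weak solution with datum `U T_*`
  have huw : FunctionSpaces.Torus.IsWeakNSSolutionWithDataOn (T - Ts) 1 (U Ts) u :=
    isWeakNSSolutionWithDataOn_of_classical_Ioc hTs' hucl huL2 (fun t ht x => (hCb t ht x).1) hulim
  -- the solution of Thm. 1.1: `U` up to `T_*`, then the translated construction
  set w : ℝ → UnitAddTorus (Fin n) → EuclideanSpace ℝ (Fin n) := fun t => if t ≤ Ts then U t else u (t - Ts) with hw_def
  have hw_le : ∀ t, t ≤ Ts → w t = U t := fun t ht => by simp [hw_def, ht]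
  have hw_gt : ∀ t, Ts < t → w t = u (t - Ts) := fun t ht => by simp [hw_def, not_le.2 ht]
  -- the translated classical solution on `(T_*, T]`
  have hucl' : FunctionSpaces.Torus.IsClassicalNSSolutionOn (Ioc Ts T) 1 0 w (fun t => q (t - Ts)) := by
    have h := isClassicalNSSolutionOn_Ioc_translate (a := Ts) hucl
    rw [add_sub_cancel] at h
    exact h.congr (fun t ht => hw_gt t ht.1) (fun _ _ => rfl)
  refine ⟨w, ?_, ?_, ?_, ⟨fun t => q (t - Ts), hucl'⟩, ?_, ?_, ?_, ?_, ?_, ?_⟩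
  · -- weak solution on `[0, T)` with datum `u₀`
    rcases hTs0.eq_or_lt with hTs | hTs
    · -- `T_* = 0`: the construction itself
      subst hTs
      rw [sub_zero] at huw
      rw [hU0] at huw
      exact isWeakNSSolutionWithDataOn_congr_Ioo huw fun t ht => by rw [hw_gt t ht.1, sub_zero]
    · -- `T_* > 0`: glue `U` and `u(· - T_*)` at `T_*` (Lemma 6.1 with the tree's gluing)
      exact hUw.glue hTs hTsT (⟨hTs, hTsT⟩ : Ts ∈ Ioo 0 T) hUsm.continuousOn_stLift huw
  · -- `w 0 = u₀`
    rw [hw_le 0 hTs0, hU0]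
  · -- classical on `[0, T_*]` for `T_* > 0`
    intro hTs
    exact ⟨P, (hUT.mono (Icc_subset_Icc le_rfl hTsT.le) (uniqueDiffOn_Icc hTs)).congr
      (fun t ht => hw_le t ht.2) (fun _ _ => rfl)⟩
  · -- smooth at every time (Rmk. 1.2)
    intro t ht
    by_cases hts : t ≤ Ts
    · rw [hw_le t hts]
      exact hUsm.isSmooth_slice ht
    · rw [hw_gt t (not_le.1 hts)]
      exact husm.isSmooth_slice ⟨by linarith [not_le.1 hts], by linarith [ht.2]⟩
  · -- blow-up from the right along `T_* + sₖ`
    refine ⟨c, hc, fun k => Ts + s k, fun k => ⟨by linarith [(hsI k).1], by linarith [(hsI k).2]⟩,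
      ?_, fun k => ?_⟩
    · simpa using tendsto_const_nhds.add hslim
    · obtain ⟨x, hx⟩ := hlow k
      refine ⟨x, ?_⟩
      rw [hw_gt _ (by linarith [(hsI k).1]), add_sub_cancel_left]
      exact hx
  · -- Type I
    refine ⟨C, fun t ht x => ?_⟩
    rw [hw_gt t ht.1]
    exact hCb (t - Ts) ⟨sub_pos.2 ht.1, by linarith [ht.2]⟩ x
  · -- the weakened Ladyzhenskaya–Prodi–Serrin integral
    refine ⟨c₁, hc₁, ?_⟩
    have hsub : Ioo 0 T ⊆ Ioc 0 Ts ∪ Ioo Ts T := fun t ht => by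
      by_cases hts : t ≤ Ts
      · exact Or.inl ⟨ht.1, hts⟩
      · exact Or.inr ⟨not_le.1 hts, ht.2⟩
    refine IntegrableOn.mono_set (IntegrableOn.union ?_ ?_) hsub
    · -- on `(0, T_*]` the field is the bounded smooth `U`
      have hg : ContinuousOn (fun t => ⨆ x, ‖U t x‖) (Icc 0 T) := continuousOn_iSup_norm hUsm
      have hF := continuousOn_orliczWeight hc₁ 2 hg fun t => Real.iSup_nonneg fun x => norm_nonneg _
      refine ((hF.integrableOn_Icc).mono_set (Ioc_subset_Icc_self.trans
        (Icc_subset_Icc le_rfl hTsT.le))).congr_fun (fun t ht => ?_) measurableSet_Ioc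
      simp only [hw_le t ht.2]
    · -- on `(T_*, T)` it is the translated construction
      have h := integrableOn_Ioo_comp_sub (a := Ts) hI₁
      rw [add_sub_cancel] at h
      refine h.congr_fun (fun t ht => ?_) measurableSet_Ioo
      simp only [hw_gt t ht.1]
  · -- the weakened Beale–Kato–Majda integral
    refine ⟨c₂, hc₂, ?_⟩
    have hsub : Ioo 0 T ⊆ Ioc 0 Ts ∪ Ioo Ts T := fun t ht => by
      by_cases hts : t ≤ Ts
      · exact Or.inl ⟨ht.1, hts⟩
      · exact Or.inr ⟨not_le.1 hts, ht.2⟩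
    refine IntegrableOn.mono_set (IntegrableOn.union ?_ ?_) hsub
    · have hg : ContinuousOn (fun t => ⨆ x, ‖FunctionSpaces.Torus.fderiv (U t) x‖) (Icc 0 T) :=
        continuousOn_iSup_norm_fderiv hT hUsm
      have hF := continuousOn_orliczWeight hc₂ 1 hg fun t => Real.iSup_nonneg fun x => norm_nonneg _
      simp only [pow_one] at hF
      refine ((hF.integrableOn_Icc).mono_set (Ioc_subset_Icc_self.trans
        (Icc_subset_Icc le_rfl hTsT.le))).congr_fun (fun t ht => ?_) measurableSet_Ioc
      simp only [hw_le t ht.2]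
    · have h := integrableOn_Ioo_comp_sub (a := Ts) hI₂
      rw [add_sub_cancel] at h
      refine h.congr_fun (fun t ht => ?_) measurableSet_Ioo
      simp only [hw_gt t ht.1]
  · -- `L²(0, T; L^p)` for all `p < ∞` (Prop. 6.2 for the construction; `U` is bounded)
    intro p hp
    have hULp : FluidPDE.Torus.MemLqLp 2 (ENNReal.ofReal p) U (Ioo 0 T) :=
      memLqLp_of_norm_le (fun t ht => (hUsm.isSmooth_slice (Ioo_subset_Icc_self ht)).continuous)
        fun t ht x => hM t (Ioo_subset_Icc_self ht) x
    rcases hTs0.eq_or_lt with hTs | hTs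
    · subst hTs
      have h := huLp p hp
      rw [sub_zero] at h
      exact memLqLp_congr_set measurableSet_Ioo h fun t ht => by rw [hw_gt t ht.1, sub_zero]
    · exact FluidPDE.Torus.memLqLp_glue hTs hTsT hULp (huLp p hp)

end Assembly

end Literature.Barriers.NavierStokesRegularity

end
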